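import Summits.QuantumFields.YangMills.Theorems.BalabanUVNodesN15CovariantTwoGridPairingLetters
import Summits.QuantumFields.YangMills.Theorems.BalabanUVNodesN15CovariantAveragingTransportSizes
import Summits.QuantumFields.YangMills.Theorems.BalabanUVNodesN15CovariantAveragingHolonomy
import Summits.QuantumFields.YangMills.Theorems.BalabanUVNodesN15PerCubeGreenTwoGridCutRows
import HarnessLib

/-!
# N15 = NE2, road (c) — PROGRAMME (PC) «[B9] Sect. C FOR THE LANDAU LETTER WITH PER-CUBE GAUGES (3.35) AS PRINTED», (PC-E) (C6-d1): THE FIRST-ORDER SPECIES FIT ACROSS KING's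
# PAIRING — n15-c∕340's `hfitA` under the covariant pairing: `η′⁻¹(S′_μ(x′) − 1)` against `η⁻¹(S_μ(πx′) − 1)` where `S_μ(y) = Π_{t<L^r} S′_μ(σy + te′_μ)` is a product of `L^r` factors;
# the product TELESCOPES (`ΠF − 1 = Σ_t (Π_{s<t}F_s)(F_t − 1)`), so the fit is the cell OSCILLATION of the fine coefficient plus a second-order term `((1+|ι|ε)^{L^r} − 1)ε = O(η)`
# (dag-n15-c g32, n15-c∕343)

Cell `pub-ymgap`, seat `pub-ymgap-dag-n15-c` (generation g32; R134 (a) seat, strategy s1 «first missing estimate»; HUMAN RULING D-0062; chair R424 venue).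
`bears_on: R4∕N15 · K3⁸ SpineGivenEndpointR13SepCoPHV (stmt-QuantumFields-27366)`; filed `--kind proof --supports stmt-QuantumFields-27366 --as helper` — COUNT-NEUTRAL.
THEOREMS only ([folklore] real-matrix product algebra + one elementary estimate), 0 `def`, 0 `sorry`.  Imports BY NAME n15-c∕341 `…CovariantTwoGridPairingLetters` (`gauged_lineHol_eq_mprod`,
`kingSec_sub_unitVec`), n15-c∕182 `…CovariantAveragingTransportSizes` (`rows_mprod_sub_one_le`), n15-c∕185a `…CovariantAveragingHolonomy` (`coordMat_Ad_mprod`), dag-n15-a ✓p794216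
`…PerCubeGreenTwoGridCutRows` (`scChi'_eq_scChi_kingPr`); through them n15-c∕181 `mprod`, dag-n15-w2 `uN_abs_coordMat_conj_sub_one_entry_le_op`∕`_sub_conj_entry_le_op`,
`uN_gaugeTransformed_bond_unitary`, n15-b `tCoefA_inl`∕`tCoefA_inr`, dag-n15-w3 `gaugePair_inl`∕`gaugePair_inr`.  Nothing in the tree is modified, no landed name re-declared.

WHY (n15-c∕340 `uN_idef_scGreen_tr`, displayed row `hfitC`∕`hfitA`∕`hDNV` = the PAIRING data).  `hfitA` compares the first-order coefficients `a⁺_μ = η⁻¹(S_μ − 1)`, `a⁻_μ(x) = η⁻¹(1 − S_μ(x−e_μ)ᵀ)`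
of the transformed bond variables across King's pairing `π`: `Σ_j|(χ′_k(x′)a′^±_μ(x′) − χ_k(πx′)a^±_μ(πx′))_{ij}| ≤ o_V`.  Under the covariant pairing (n15-c∕341: coarse bond variable = the
straight fine holonomy, so in the induced gauge `V_μ(y) = Π_{t<L^r}V′_μ(σy + te′_μ)` and, `Ad` being multiplicative — n15-c∕185a `coordMat_Ad_mprod` —, `S_μ(y) = Π_{t<L^r}S′_μ(σy + te′_μ)`)
this is an ELEMENTARY estimate: ★★ `abs_fit_mprod_entry_le` — for real matrices `F_t` (`t < N`) within `ε` of `1` entrywise and `G` within `ω` of every `F_t`,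
`|(c(G − 1) − (c∕N)(Π_tF_t − 1))_{ij}| ≤ c·(ω + ((1+|ι|ε)^N − 1)ε)` (telescoping `ΠF − 1 = Σ_t(Π_{s<t}F_s)(F_t − 1)`, ★ `mprod_sub_one_eq_sum`; rows of `Π_{s<t}F_s − 1 ≤ (1+|ι|ε)^N − 1`,
n15-c∕182).  At `c = η′⁻¹`, `N = L^r` (`c∕N = η⁻¹`), `ε = η′·κ_e2√|m|√|m|p` (the (3.35) letter), `ω = κ_e2√|m|√|m|·Ω` with `Ω` the OSCILLATION of `V′_μ` between `x′` and the fine line over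
`πx′` (displayed; from the second (3.35) letter it is `O(L^rη′²q) = O(ηη′q)`, the geometry is the sequel's), the fit is `|ι|(κΩ∕η′ + κp((1+|ι|η′κp)^{L^r} − 1)) = O(η)`.

RESULTS.  §1 (ns CovAvg, [folklore]) `mprod_sub_one_eq_sum`, `abs_mul_entry_le_rows`, ★★ `abs_fit_mprod_entry_le`.  §2 ((PC) site carriers, ns Gluing) ★★ `abs_tCoefA_inl_fit_le` ∕
★★ `abs_tCoefA_inr_fit_le` (the forward ∕ backward coefficient fits at a fine site from the pointwise letter on the fine line and the displayed oscillation), ★★★ `sc_hfitA_of_pairing`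
(n15-c∕340's `hfitA` LITERALLY, per cube `k`, from: the covariant pairing, unitary `u′_k`, `U′`, the letter `‖V′ − 1‖ ≤ η′p` on sets `Qf k` containing the fine lines over the cut box and its
`−e_μ` neighbours, and the oscillation letter `Ω` there).

HONEST FRAMING ∕ LIMITS.  Elementary; MODEL pairing (straight holonomy); the oscillation letter `Ω` and the set geometry stay displayed (sequel: `Ω = 2((d+1)(L^r−1) + L^r)·η′²q` by fibre
walks, dag-n15-a `fibre_conn_kingPrV` localized); nothing of [B7]∕[B9] asserted ((3.35) p.396, (3.51)–(3.52) p.400 = SHAPES; [B9] Thm 3.14 is the DOMAIN-change theorem and is cited by this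
lane as a template only).  NE2⁺ NOT PRINTED, NOT proved; N15 of record untouched (DISCHARGED AS CONSUMED, p687738); K3⁸ OPEN; counts of record UNMOVED (typed 28∕28 · discharged 8∕27); one
finite 𝕋⁴ at fixed ε per index — NOT infinite volume, NOT OS on ℝ⁴, NOT a mass gap, NOT Clay.  Restate-immune (no Theses import).
-/

set_option autoImplicit false

noncomputable section

open scoped BigOperators Matrix Matrix.Norms.L2Operator
open Finset

/-! ## §1 Real-matrix product algebra: the telescoping sum and the entrywise two-grid fit -/

namespace Summit.QuantumFields.YangMills.BalabanUVNodes.N15.CovAvg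

section Core

variable {ι : Type} [Fintype ι] [DecidableEq ι]

/-- TELESCOPING: `Π_{t<N}F_t − 1 = Σ_{t<N} (Π_{s<t}F_s)·(F_t − 1)`. [folklore] -/
theorem mprod_sub_one_eq_sum (F : ℕ → Matrix ι ι ℝ) (N : ℕ) : mprod F N - 1 = ∑ t ∈ range N, mprod F t * (F t - 1) := by
  induction N with
  | zero => rw [mprod_zero, sub_self, Finset.sum_range_zero]
  | succ N ih => rw [Finset.sum_range_succ, ← ih, mprod_succ, Matrix.mul_sub, Matrix.mul_one]; abel

omit [DecidableEq ι] in
/-- an entry of a product: `|(AB)_{ij}| ≤ (Σ_l|A_{il}|)·ε` when `|B_{lj}| ≤ ε`. [folklore] -/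
theorem abs_mul_entry_le_rows {A B : Matrix ι ι ℝ} {ε : ℝ} (hB : ∀ l j, |B l j| ≤ ε) (i j : ι) : |(A * B) i j| ≤ (∑ l, |A i l|) * ε := by
  rw [Matrix.mul_apply, Finset.sum_mul]
  refine (Finset.abs_sum_le_sum_abs _ _).trans (Finset.sum_le_sum fun l _ => ?_)
  rw [abs_mul]; exact mul_le_mul_of_nonneg_left (hB l j) (abs_nonneg _)

/-- ★★ **THE ENTRYWISE TWO-GRID FIT OF A FIRST-ORDER COEFFICIENT AGAINST A PRODUCT OF `N` NEAR-IDENTITY FACTORS**: `|(F_t − 1)_{ij}| ≤ ε` (`t < N`), `|(G − F_t)_{ij}| ≤ ω` ⟹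
`|(c(G − 1) − (c∕N)(Π_{t<N}F_t − 1))_{ij}| ≤ c·(ω + ((1 + |ι|ε)^N − 1)·ε)` — telescoping, `(G − 1) − P_t(F_t − 1) = (G − F_t) − (P_t − 1)(F_t − 1)`, rows of `P_t − 1 ≤ (1+|ι|ε)^N − 1`
(n15-c∕182 `rows_mprod_sub_one_le`).  At `c = η′⁻¹`, `N = L^r`: the two-grid fit of `a⁺ = η⁻¹(S − 1)`, `O(η)`.
[cite: Balaban1985BackgroundPropagators, (3.51)–(3.52) p.400, (3.35) p.396 (shapes); King1986, p.664 (pairing)] -/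
theorem abs_fit_mprod_entry_le {F : ℕ → Matrix ι ι ℝ} {G : Matrix ι ι ℝ} {ε ω c : ℝ} (hε : 0 ≤ ε) (hc : 0 ≤ c) {N : ℕ} (hN : N ≠ 0)
    (hF : ∀ t < N, ∀ i j, |(F t - 1) i j| ≤ ε) (hG : ∀ t < N, ∀ i j, |(G - F t) i j| ≤ ω) (i j : ι) :
    |(c • (G - 1) - (c / N) • (mprod F N - 1)) i j| ≤ c * (ω + ((1 + Fintype.card ι * ε) ^ N - 1) * ε) := by
  have hNr : (0 : ℝ) < N := by exact_mod_cast Nat.pos_of_ne_zero hN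
  have hρ : 0 ≤ Fintype.card ι * ε := by positivity
  -- rows of the partial products
  have hrows : ∀ t < N, ∀ i, ∑ l, |(mprod F t - 1) i l| ≤ (1 + Fintype.card ι * ε) ^ N - 1 := fun t ht i => by
    have h1 : ∀ s < t, ∀ i, ∑ j, |(F s - 1) i j| ≤ Fintype.card ι * ε := fun s hs i =>
      calc ∑ j, |(F s - 1) i j| ≤ ∑ _j : ι, ε := Finset.sum_le_sum fun j _ => hF s (hs.trans ht) i j
        _ = Fintype.card ι * ε := by rw [Finset.sum_const, Finset.card_univ, nsmul_eq_mul]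
    refine (rows_mprod_sub_one_le hρ h1 i).trans (sub_le_sub_right (pow_le_pow_right₀ (by linarith) ht.le) 1)
  -- the telescoped form of the difference
  have key : c • (G - 1) - (c / N) • (mprod F N - 1) = (c / N) • ∑ t ∈ range N, ((G - F t) - (mprod F t - 1) * (F t - 1)) := by
    have hterm : ∀ t, (G - F t) - (mprod F t - 1) * (F t - 1) = (G - 1) - mprod F t * (F t - 1) := fun t => by
      rw [Matrix.sub_mul, Matrix.one_mul]; abel
    conv_rhs => rw [Finset.sum_congr rfl (fun t _ => hterm t), Finset.sum_sub_distrib, Finset.sum_const, Finset.card_range, ← mprod_sub_one_eq_sum, smul_sub,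
      ← Nat.cast_smul_eq_nsmul ℝ N, smul_smul, div_mul_cancel₀ _ hNr.ne']
  rw [key, Matrix.smul_apply, smul_eq_mul, abs_mul, abs_of_nonneg (by positivity : 0 ≤ c / N), Matrix.sum_apply]
  have hsum : |∑ t ∈ range N, ((G - F t) - (mprod F t - 1) * (F t - 1)) i j| ≤ N * (ω + ((1 + Fintype.card ι * ε) ^ N - 1) * ε) := by
    refine (Finset.abs_sum_le_sum_abs _ _).trans ?_
    calc ∑ t ∈ range N, |((G - F t) - (mprod F t - 1) * (F t - 1)) i j| ≤ ∑ _t ∈ range N, (ω + ((1 + Fintype.card ι * ε) ^ N - 1) * ε) :=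
          Finset.sum_le_sum fun t ht => by
            have ht' := Finset.mem_range.mp ht
            rw [Matrix.sub_apply]
            exact (abs_sub _ _).trans (add_le_add (hG t ht' i j) ((abs_mul_entry_le_rows (hF t ht') i j).trans (mul_le_mul_of_nonneg_right (hrows t ht' i) hε)))
      _ = N * (ω + ((1 + Fintype.card ι * ε) ^ N - 1) * ε) := by rw [Finset.sum_const, Finset.card_range, nsmul_eq_mul]
  calc c / N * |∑ t ∈ range N, ((G - F t) - (mprod F t - 1) * (F t - 1)) i j| ≤ c / N * (N * (ω + ((1 + Fintype.card ι * ε) ^ N - 1) * ε)) :=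
        mul_le_mul_of_nonneg_left hsum (by positivity)
    _ = c * (ω + ((1 + Fintype.card ι * ε) ^ N - 1) * ε) := by field_simp

end Core

end Summit.QuantumFields.YangMills.BalabanUVNodes.N15.CovAvg

/-! ## §2 On the (PC) site carriers: the first-order species fit under the covariant pairing -/

namespace Summit.QuantumFields.YangMills.BalabanUVNodes.N15.Gluing

open Literature.MathematicalPhysics.QuantumFieldTheory.Balaban1983to89
open Literature.MathematicalPhysics.QuantumFieldTheory.Balaban1983to89.B5Prop11Plancherel (Tor fine unitVec)
open Literature.Barriers.QuantumFields (traceForm)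
open Summit.QuantumFields.YangMills.BalabanUVNodes.N15.BackgroundLayer (tCoefA tCoefA_inl tCoefA_inr)
open Summit.QuantumFields.YangMills.BalabanUVNodes.N15.VectorPiece (kingPr)
open Summit.QuantumFields.YangMills.BalabanUVNodes.N15.MatrixSpecies (coordMat basisConst basisConst_nonneg)
open Summit.QuantumFields.YangMills.BalabanUVNodes.N15.TwoGrid (abs_chiCube_le_one)
open Summit.QuantumFields.YangMills.BalabanUVNodes.N15.CurvedSpecies (gaugePair gaugePair_inl gaugePair_inr uN_abs_coordMat_conj_sub_one_entry_le_op uN_abs_coordMat_conj_sub_conj_entry_le_op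
  uN_gaugeTransformed_bond_unitary)
open Summit.QuantumFields.YangMills.BalabanUVNodes.N15.CovAvg (mprod kingSec kingSec_sub_unitVec kingPr_kingSec gauged_lineHol_eq_mprod abs_fit_mprod_entry_le coordMat_Ad_mprod)

variable {d : ℕ} {L : ℕ} [NeZero L] {mv kk r : ℕ} {hL : Odd L ∧ 1 < L} {mm : Type} [Fintype mm] [DecidableEq mm] {ι : Type} [Fintype ι] [DecidableEq ι]
  (e : Matrix mm mm ℂ ≃L[ℝ] (ι → ℝ))

/-- ★★ **THE FORWARD COEFFICIENT FIT AT A FINE SITE, UNDER THE COVARIANT PAIRING**: with `V′_μ(z) = u′(z)U′_μ(z)u′(z+e′_μ)ᴴ`, the coarse bond variable `U_μ(y) = Π_{t<L^r}U′_μ(σy + te′_μ)`,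
`S′ = coordMat e Ad_{V′}`, `S = coordMat e Ad_V` (induced gauge), the letter `‖V′_μ(z_t) − 1‖ ≤ η′p` on the fine line `z_t = σy + te′_μ` over a coarse site `y` and the oscillation
`‖V′_μ(x′) − V′_μ(z_t)‖ ≤ Ω` from a fine site `x′`: `|(η′⁻¹(S′_μ(x′) − 1) − η⁻¹(S_μ(y) − 1))_{ij}| ≤ η′⁻¹(κΩ + ((1+|ι|η′κp)^{L^r} − 1)·η′κp)`, `κ = κ_e2√|m|√|m|`.
[cite: Balaban1985BackgroundPropagators, (3.51)–(3.52) p.400, (3.35) p.396 (shapes); Balaban1985Averaging, (124)–(125) p.36 (pairing: shape); King1986, p.664] -/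
theorem abs_tCoefA_fit_entry_le {u' : ScX' d L mv kk r hL → Matrix mm mm ℂ} (hu' : ∀ z, (u' z)ᴴ * u' z = 1)
    {U' : Fin (d + 1) → ScX' d L mv kk r hL → Matrix mm mm ℂ} (hU' : ∀ μ z, (U' μ z)ᴴ * U' μ z = 1) {U : Fin (d + 1) → ScX d L mv kk hL → Matrix mm mm ℂ} (μ : Fin (d + 1))
    (hpair : ∀ y, U μ y = mprod (fun t => U' μ (kingSec (cvM d L mv kk hL) L kk r y + t • unitVec (fine (L ^ r * L ^ kk) (cvM d L mv kk hL)) μ)) (L ^ r))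
    {p Ω : ℝ} (hp : 0 ≤ p) (y : ScX d L mv kk hL) (x' : ScX' d L mv kk r hL)
    (hline : ∀ t < L ^ r, ‖u' (kingSec (cvM d L mv kk hL) L kk r y + t • unitVec (fine (L ^ r * L ^ kk) (cvM d L mv kk hL)) μ) * U' μ (kingSec (cvM d L mv kk hL) L kk r y + t • unitVec (fine (L ^ r * L ^ kk) (cvM d L mv kk hL)) μ) *
      (u' (kingSec (cvM d L mv kk hL) L kk r y + t • unitVec (fine (L ^ r * L ^ kk) (cvM d L mv kk hL)) μ + unitVec (fine (L ^ r * L ^ kk) (cvM d L mv kk hL)) μ))ᴴ - 1‖ ≤ ((((L ^ r * L ^ kk : ℕ) : ℝ))⁻¹) * p)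
    (hosc : ∀ t < L ^ r, ‖u' x' * U' μ x' * (u' (scShift' d L mv kk r hL μ x'))ᴴ -
      u' (kingSec (cvM d L mv kk hL) L kk r y + t • unitVec (fine (L ^ r * L ^ kk) (cvM d L mv kk hL)) μ) * U' μ (kingSec (cvM d L mv kk hL) L kk r y + t • unitVec (fine (L ^ r * L ^ kk) (cvM d L mv kk hL)) μ) *
      (u' (kingSec (cvM d L mv kk hL) L kk r y + t • unitVec (fine (L ^ r * L ^ kk) (cvM d L mv kk hL)) μ + unitVec (fine (L ^ r * L ^ kk) (cvM d L mv kk hL)) μ))ᴴ‖ ≤ Ω) (i j : ι) :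
    |(((((L ^ r * L ^ kk : ℕ) : ℝ))⁻¹)⁻¹ • (coordMat e (ContinuousLinearMap.mulLeftRight ℝ (Matrix mm mm ℂ) (u' x' * U' μ x' * (u' (scShift' d L mv kk r hL μ x'))ᴴ) (u' x' * U' μ x' * (u' (scShift' d L mv kk r hL μ x'))ᴴ)ᴴ) - 1) -
        ((((L ^ kk : ℕ) : ℝ))⁻¹)⁻¹ • (coordMat e (ContinuousLinearMap.mulLeftRight ℝ (Matrix mm mm ℂ) (u' (kingSec (cvM d L mv kk hL) L kk r y) * U μ y * (u' (kingSec (cvM d L mv kk hL) L kk r (scShift d L mv kk hL μ y)))ᴴ)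
          (u' (kingSec (cvM d L mv kk hL) L kk r y) * U μ y * (u' (kingSec (cvM d L mv kk hL) L kk r (scShift d L mv kk hL μ y)))ᴴ)ᴴ) - 1)) i j| ≤
      ((L ^ r * L ^ kk : ℕ) : ℝ) * (@basisConst ι _ (Matrix mm mm ℂ) Matrix.frobeniusNormedAddCommGroup Matrix.frobeniusNormedSpace e * (2 * Real.sqrt (Fintype.card mm)) * (Real.sqrt (Fintype.card mm) * Ω) +
        ((1 + Fintype.card ι * (((((L ^ r * L ^ kk : ℕ) : ℝ))⁻¹) * (@basisConst ι _ (Matrix mm mm ℂ) Matrix.frobeniusNormedAddCommGroup Matrix.frobeniusNormedSpace e * (2 * Real.sqrt (Fintype.card mm)) * (Real.sqrt (Fintype.card mm) * p)))) ^ (L ^ r) - 1) *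
          (((((L ^ r * L ^ kk : ℕ) : ℝ))⁻¹) * (@basisConst ι _ (Matrix mm mm ℂ) Matrix.frobeniusNormedAddCommGroup Matrix.frobeniusNormedSpace e * (2 * Real.sqrt (Fintype.card mm)) * (Real.sqrt (Fintype.card mm) * p)))) := by
  have hLpos : 0 < L := Nat.pos_of_ne_zero (NeZero.ne L)
  have hLr : 0 < L ^ r := pow_pos hLpos r
  have hnr : (0 : ℝ) < ((L ^ kk : ℕ) : ℝ) := by exact_mod_cast pow_pos hLpos kk
  have hnr' : (0 : ℝ) < ((L ^ r * L ^ kk : ℕ) : ℝ) := by exact_mod_cast Nat.mul_pos hLr (pow_pos hLpos kk)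
  set κ : ℝ := @basisConst ι _ (Matrix mm mm ℂ) Matrix.frobeniusNormedAddCommGroup Matrix.frobeniusNormedSpace e * (2 * Real.sqrt (Fintype.card mm)) with hκ
  have hκ0 : 0 ≤ κ := mul_nonneg (@basisConst_nonneg ι _ (Matrix mm mm ℂ) Matrix.frobeniusNormedAddCommGroup Matrix.frobeniusNormedSpace e) (by positivity)
  -- the fine factors along the line and their letters
  set z : ℕ → ScX' d L mv kk r hL := fun t => kingSec (cvM d L mv kk hL) L kk r y + t • unitVec (fine (L ^ r * L ^ kk) (cvM d L mv kk hL)) μ with hz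
  set V : ℕ → Matrix mm mm ℂ := fun t => u' (z t) * U' μ (z t) * (u' (z t + unitVec (fine (L ^ r * L ^ kk) (cvM d L mv kk hL)) μ))ᴴ with hV
  set F : ℕ → Matrix ι ι ℝ := fun t => coordMat e (ContinuousLinearMap.mulLeftRight ℝ (Matrix mm mm ℂ) (V t) (V t)ᴴ) with hF
  have hVu : ∀ t, (V t)ᴴ * V t = 1 := fun t => uN_gaugeTransformed_bond_unitary (scShift' d L mv kk r hL) u' U' hu' hU' μ (z t)
  have hWu : (u' x' * U' μ x' * (u' (scShift' d L mv kk r hL μ x'))ᴴ)ᴴ * (u' x' * U' μ x' * (u' (scShift' d L mv kk r hL μ x'))ᴴ) = 1 :=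
    uN_gaugeTransformed_bond_unitary (scShift' d L mv kk r hL) u' U' hu' hU' μ x'
  have hFε : ∀ t < L ^ r, ∀ i j, |(F t - 1) i j| ≤ ((((L ^ r * L ^ kk : ℕ) : ℝ))⁻¹) * (κ * (Real.sqrt (Fintype.card mm) * p)) := fun t ht i j => by
    refine (uN_abs_coordMat_conj_sub_one_entry_le_op e (hVu t) i j).trans ?_
    calc κ * (Real.sqrt (Fintype.card mm) * ‖V t - 1‖) ≤ κ * (Real.sqrt (Fintype.card mm) * (((((L ^ r * L ^ kk : ℕ) : ℝ))⁻¹) * p)) := by gcongr; exact hline t ht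
      _ = _ := by ring
  have hGω : ∀ t < L ^ r, ∀ i j, |(coordMat e (ContinuousLinearMap.mulLeftRight ℝ (Matrix mm mm ℂ) (u' x' * U' μ x' * (u' (scShift' d L mv kk r hL μ x'))ᴴ) (u' x' * U' μ x' * (u' (scShift' d L mv kk r hL μ x'))ᴴ)ᴴ) - F t) i j| ≤
      κ * (Real.sqrt (Fintype.card mm) * Ω) := fun t ht i j => by
    refine (uN_abs_coordMat_conj_sub_conj_entry_le_op e (hVu t) hWu i j).trans ?_
    gcongr; exact hosc t ht
  -- the coarse transporter is the product of the fine ones (n15-c∕341 + n15-c∕185a)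
  have hS : coordMat e (ContinuousLinearMap.mulLeftRight ℝ (Matrix mm mm ℂ) (u' (kingSec (cvM d L mv kk hL) L kk r y) * U μ y * (u' (kingSec (cvM d L mv kk hL) L kk r (scShift d L mv kk hL μ y)))ᴴ)
      (u' (kingSec (cvM d L mv kk hL) L kk r y) * U μ y * (u' (kingSec (cvM d L mv kk hL) L kk r (scShift d L mv kk hL μ y)))ᴴ)ᴴ) = mprod F (L ^ r) := by
    rw [hpair y, show scShift d L mv kk hL μ y = y + unitVec (fine (L ^ kk) (cvM d L mv kk hL)) μ from rfl, gauged_lineHol_eq_mprod (cvM d L mv kk hL) L kk r hu' U' μ y,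
      ← coordMat_Ad_mprod]
  -- the numerics `η⁻¹ = η′⁻¹ ∕ L^r`
  have hc : ((((L ^ kk : ℕ) : ℝ))⁻¹)⁻¹ = ((((L ^ r * L ^ kk : ℕ) : ℝ))⁻¹)⁻¹ / ((L ^ r : ℕ) : ℝ) := by
    rw [inv_inv, inv_inv, Nat.cast_mul, mul_div_cancel_left₀ _ (by exact_mod_cast hLr.ne')]
  rw [hS, hc]
  refine (abs_fit_mprod_entry_le (c := ((((L ^ r * L ^ kk : ℕ) : ℝ))⁻¹)⁻¹) (by positivity) (by rw [inv_inv]; exact hnr'.le) (pow_pos hLpos r).ne' hFε hGω i j).trans (le_of_eq ?_)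
  rw [inv_inv]

omit [Fintype ι] in
/-- the backward coefficient is minus the transpose of the forward one at the previous site: entrywise, `(c(1 − Aᵀ) − c′(1 − Bᵀ))_{ij} = −(c(A − 1) − c′(B − 1))_{ji}`. [folklore] -/
theorem sub_transpose_fit_entry (c c' : ℝ) (A B : Matrix ι ι ℝ) (i j : ι) :
    (c • (1 - Aᵀ) - c' • (1 - Bᵀ)) i j = -((c • (A - 1) - c' • (B - 1)) j i) := by
  simp only [Matrix.sub_apply, Matrix.smul_apply, Matrix.transpose_apply, Matrix.one_apply, smul_eq_mul]
  by_cases h : i = j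
  · subst h; simp; ring
  · rw [if_neg h, if_neg (Ne.symm h)]; ring

/-- ★★★ **n15-c∕340's `hfitA` UNDER THE COVARIANT PAIRING, LITERALLY**: per cube `k`, a unitary fine gauge `u′_k`, a unitary fine bond field `U′`, the coarse bond field
`U_μ = Π_{t<L^r}U′_μ(σ· + te′_μ)` (n15-c∕341), the letter `‖V′_μ(z) − 1‖ ≤ η′p` on sets `Qf k` containing the fine lines over the coarse cut box of `k` and its `−e_μ` neighbours, and the
OSCILLATION letter `Ω` between each fine site `x′` (resp. `x′ − e′_μ`) over the cut box and the fine line over `πx′` (resp. `πx′ − e_μ`): the two-grid fit of the first-order species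
coefficients in the cube gauges (fine `u′_k`, coarse INDUCED `u′_k∘σ`) is `≤ |ι|·(L^rL^k)·(κΩ + ((1+|ι|η′κp)^{L^r} − 1)η′κp)` (`κ = κ_e2√|m|√|m|`) — `O(η)` once `Ω = O(ηη′)`.
[cite: Balaban1985BackgroundPropagators, (3.51)–(3.52) p.400, (3.35) p.396 (shapes); Balaban1985Averaging, (124)–(125) p.36 (pairing: shape); King1986, p.664 (pairing)] -/
theorem sc_hfitA_of_pairing (u' : (Fin (d + 1) → ZMod (2 * L)) → ScX' d L mv kk r hL → Matrix mm mm ℂ) (hu' : ∀ k z, (u' k z)ᴴ * u' k z = 1)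
    (U' : Fin (d + 1) → ScX' d L mv kk r hL → Matrix mm mm ℂ) (hU' : ∀ μ z, (U' μ z)ᴴ * U' μ z = 1) (U : Fin (d + 1) → ScX d L mv kk hL → Matrix mm mm ℂ)
    (hpair : ∀ μ y, U μ y = mprod (fun t => U' μ (kingSec (cvM d L mv kk hL) L kk r y + t • unitVec (fine (L ^ r * L ^ kk) (cvM d L mv kk hL)) μ)) (L ^ r))
    (Qf : (Fin (d + 1) → ZMod (2 * L)) → Set (ScX' d L mv kk r hL)) {p Ω : ℝ} (hp : 0 ≤ p) (hΩ0 : 0 ≤ Ω)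
    (hF1 : ∀ k μ z, z ∈ Qf k → ‖u' k z * U' μ z * (u' k (scShift' d L mv kk r hL μ z))ᴴ - 1‖ ≤ ((((L ^ r * L ^ kk : ℕ) : ℝ))⁻¹) * p)
    (hQl : ∀ k x', scChi d L mv kk hL k (kingPr L kk r (cvM d L mv kk hL) x') ≠ 0 → ∀ μ t, t < L ^ r → kingSec (cvM d L mv kk hL) L kk r (kingPr L kk r (cvM d L mv kk hL) x') + t • unitVec (fine (L ^ r * L ^ kk) (cvM d L mv kk hL)) μ ∈ Qf k ∧ kingSec (cvM d L mv kk hL) L kk r ((scShift d L mv kk hL μ).symm (kingPr L kk r (cvM d L mv kk hL) x')) + t • unitVec (fine (L ^ r * L ^ kk) (cvM d L mv kk hL)) μ ∈ Qf k)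
    (hΩ : ∀ k μ x', scChi d L mv kk hL k (kingPr L kk r (cvM d L mv kk hL) x') ≠ 0 → ∀ t < L ^ r, ‖u' k x' * U' μ x' * (u' k (scShift' d L mv kk r hL μ x'))ᴴ - (u' k (kingSec (cvM d L mv kk hL) L kk r (kingPr L kk r (cvM d L mv kk hL) x') + t • unitVec (fine (L ^ r * L ^ kk) (cvM d L mv kk hL)) μ) * U' μ (kingSec (cvM d L mv kk hL) L kk r (kingPr L kk r (cvM d L mv kk hL) x') + t • unitVec (fine (L ^ r * L ^ kk) (cvM d L mv kk hL)) μ) * (u' k (kingSec (cvM d L mv kk hL) L kk r (kingPr L kk r (cvM d L mv kk hL) x') + t • unitVec (fine (L ^ r * L ^ kk) (cvM d L mv kk hL)) μ + unitVec (fine (L ^ r * L ^ kk) (cvM d L mv kk hL)) μ))ᴴ)‖ ≤ Ω ∧ ‖u' k ((scShift' d L mv kk r hL μ).symm x') * U' μ ((scShift' d L mv kk r hL μ).symm x') * (u' k (scShift' d L mv kk r hL μ ((scShift' d L mv kk r hL μ).symm x')))ᴴ - (u' k (kingSec (cvM d L mv kk hL) L kk r ((scShift d L mv kk hL μ).symm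 (kingPr L kk r (cvM d L mv kk hL) x')) + t • unitVec (fine (L ^ r * L ^ kk) (cvM d L mv kk hL)) μ) * U' μ (kingSec (cvM d L mv kk hL) L kk r ((scShift d L mv kk hL μ).symm (kingPr L kk r (cvM d L mv kk hL) x')) + t • unitVec (fine (L ^ r * L ^ kk) (cvM d L mv kk hL)) μ) * (u' k (kingSec (cvM d L mv kk hL) L kk r ((scShift d L mv kk hL μ).symm (kingPr L kk r (cvM d L mv kk hL) x')) + t • unitVec (fine (L ^ r * L ^ kk) (cvM d L mv kk hL)) μ + unitVec (fine (L ^ r * L ^ kk) (cvM d L mv kk hL)) μ))ᴴ)‖ ≤ Ω) :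
    ∀ k j' x' i, ∑ j, |(scChi' d L mv kk r hL k x' • tCoefA ((((L ^ r * L ^ kk : ℕ) : ℝ))⁻¹) (gaugePair (scShift' d L mv kk r hL) fun μ x' => coordMat e (ContinuousLinearMap.mulLeftRight ℝ (Matrix mm mm ℂ) (u' k x' * U' μ x' * (u' k (scShift' d L mv kk r hL μ x'))ᴴ) (u' k x' * U' μ x' * (u' k (scShift' d L mv kk r hL μ x'))ᴴ)ᴴ)) j' x') i j - (scChi d L mv kk hL k ((kingPr L kk r (cvM d L mv kk hL)) x') • tCoefA ((((L ^ kk : ℕ) : ℝ))⁻¹) (gaugePair (scShift d L mv kk hL) fun μ x => coordMat e (ContinuousLinearMap.mulLeftRight ℝ (Matrix mm mm ℂ) (u' k (kingSec (cvM d L mv kk hL) L kk r x) * U μ x * (u' k (kingSec (cvM d L mv kk hL) L kk r (scShift d L mv kk hL μ x)))ᴴ) (u' k (kingSec (cvM d L mv kk hL) L kk r x) * U μ x * (u' k (kingSec (cvM d L mv kk hL) L kk r (scShift d L mv kk hL μ x)))ᴴ)ᴴ)) j' ((kingPr L kk r (cvM d L mv kk hL)) x')) i j| ≤ Fintype.card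 ι * (((L ^ r * L ^ kk : ℕ) : ℝ) * (@basisConst ι _ (Matrix mm mm ℂ) Matrix.frobeniusNormedAddCommGroup Matrix.frobeniusNormedSpace e * (2 * Real.sqrt (Fintype.card mm)) * (Real.sqrt (Fintype.card mm) * Ω) + ((1 + Fintype.card ι * (((((L ^ r * L ^ kk : ℕ) : ℝ))⁻¹) * (@basisConst ι _ (Matrix mm mm ℂ) Matrix.frobeniusNormedAddCommGroup Matrix.frobeniusNormedSpace e * (2 * Real.sqrt (Fintype.card mm)) * (Real.sqrt (Fintype.card mm) * p)))) ^ (L ^ r) - 1) * (((((L ^ r * L ^ kk : ℕ) : ℝ))⁻¹) * (@basisConst ι _ (Matrix mm mm ℂ) Matrix.frobeniusNormedAddCommGroup Matrix.frobeniusNormedSpace e * (2 * Real.sqrt (Fintype.card mm)) * (Real.sqrt (Fintype.card mm) * p))))) := by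
  have hLpos : 0 < L := Nat.pos_of_ne_zero (NeZero.ne L)
  set κ : ℝ := @basisConst ι _ (Matrix mm mm ℂ) Matrix.frobeniusNormedAddCommGroup Matrix.frobeniusNormedSpace e * (2 * Real.sqrt (Fintype.card mm)) with hκ
  have hκ0 : 0 ≤ κ := mul_nonneg (@basisConst_nonneg ι _ (Matrix mm mm ℂ) Matrix.frobeniusNormedAddCommGroup Matrix.frobeniusNormedSpace e) (by positivity)
  have hη' : (0 : ℝ) ≤ ((((L ^ r * L ^ kk : ℕ) : ℝ))⁻¹) := by positivity
  have hP10 : 0 ≤ ((((L ^ r * L ^ kk : ℕ) : ℝ))⁻¹) * (@basisConst ι _ (Matrix mm mm ℂ) Matrix.frobeniusNormedAddCommGroup Matrix.frobeniusNormedSpace e * (2 * Real.sqrt (Fintype.card mm)) * (Real.sqrt (Fintype.card mm) * p)) := mul_nonneg hη' (mul_nonneg hκ0 (mul_nonneg (Real.sqrt_nonneg _) hp))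
  have hB0 : 0 ≤ (((L ^ r * L ^ kk : ℕ) : ℝ) * (@basisConst ι _ (Matrix mm mm ℂ) Matrix.frobeniusNormedAddCommGroup Matrix.frobeniusNormedSpace e * (2 * Real.sqrt (Fintype.card mm)) * (Real.sqrt (Fintype.card mm) * Ω) + ((1 + Fintype.card ι * (((((L ^ r * L ^ kk : ℕ) : ℝ))⁻¹) * (@basisConst ι _ (Matrix mm mm ℂ) Matrix.frobeniusNormedAddCommGroup Matrix.frobeniusNormedSpace e * (2 * Real.sqrt (Fintype.card mm)) * (Real.sqrt (Fintype.card mm) * p)))) ^ (L ^ r) - 1) * (((((L ^ r * L ^ kk : ℕ) : ℝ))⁻¹) * (@basisConst ι _ (Matrix mm mm ℂ) Matrix.frobeniusNormedAddCommGroup Matrix.frobeniusNormedSpace e * (2 * Real.sqrt (Fintype.card mm)) * (Real.sqrt (Fintype.card mm) * p))))) := by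
    have h1 : (1 : ℝ) ≤ (1 + Fintype.card ι * (((((L ^ r * L ^ kk : ℕ) : ℝ))⁻¹) * (@basisConst ι _ (Matrix mm mm ℂ) Matrix.frobeniusNormedAddCommGroup Matrix.frobeniusNormedSpace e * (2 * Real.sqrt (Fintype.card mm)) * (Real.sqrt (Fintype.card mm) * p)))) ^ (L ^ r) := one_le_pow₀ (le_add_of_nonneg_right (mul_nonneg (Nat.cast_nonneg _) hP10))
    exact mul_nonneg (Nat.cast_nonneg _) (add_nonneg (mul_nonneg hκ0 (mul_nonneg (Real.sqrt_nonneg _) hΩ0)) (mul_nonneg (by linarith) hP10))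
  intro k j' x' i
  -- the cut-offs agree across the pairing; off the cut box both sides vanish
  rw [scChi'_eq_scChi_kingPr]
  by_cases hχ : scChi d L mv kk hL k (kingPr L kk r (cvM d L mv kk hL) x') = 0
  · simp only [hχ, zero_smul, Matrix.zero_apply, sub_self, abs_zero, Finset.sum_const_zero]
    exact mul_nonneg (Nat.cast_nonneg _) hB0
  have hc1 : |scChi d L mv kk hL k (kingPr L kk r (cvM d L mv kk hL) x')| ≤ 1 := abs_chiCube_le_one _ _
  -- the entrywise fit, forward and backward
  have hentry : ∀ j, |tCoefA ((((L ^ r * L ^ kk : ℕ) : ℝ))⁻¹) (gaugePair (scShift' d L mv kk r hL) (fun μ x' => coordMat e (ContinuousLinearMap.mulLeftRight ℝ (Matrix mm mm ℂ) (u' k x' * U' μ x' * (u' k (scShift' d L mv kk r hL μ x'))ᴴ) (u' k x' * U' μ x' * (u' k (scShift' d L mv kk r hL μ x'))ᴴ)ᴴ))) j' x' i j - tCoefA ((((L ^ kk : ℕ) : ℝ))⁻¹) (gaugePair (scShift d L mv kk hL) (fun μ x => coordMat e (ContinuousLinearMap.mulLeftRight ℝ (Matrix mm mm ℂ) (u'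 k (kingSec (cvM d L mv kk hL) L kk r x) * U μ x * (u' k (kingSec (cvM d L mv kk hL) L kk r (scShift d L mv kk hL μ x)))ᴴ) (u' k (kingSec (cvM d L mv kk hL) L kk r x) * U μ x * (u' k (kingSec (cvM d L mv kk hL) L kk r (scShift d L mv kk hL μ x)))ᴴ)ᴴ))) j' (kingPr L kk r (cvM d L mv kk hL) x') i j| ≤ (((L ^ r * L ^ kk : ℕ) : ℝ) * (@basisConst ι _ (Matrix mm mm ℂ) Matrix.frobeniusNormedAddCommGroup Matrix.frobeniusNormedSpace e * (2 * Real.sqrt (Fintype.card mm)) * (Real.sqrt (Fintype.card mm) * Ω) + ((1 + Fintype.card ι * (((((L ^ r * L ^ kk : ℕ) : ℝ))⁻¹) * (@basisConst ι _ (Matrix mm mm ℂ) Matrix.frobeniusNormedAddCommGroup Matrix.frobeniusNormedSpace e * (2 * Real.sqrt (Fintype.card mm)) * (Real.sqrt (Fintype.card mm) * p)))) ^ (L ^ r) - 1) * (((((L ^ r * L ^ kk : ℕ) : ℝ))⁻¹) * (@basisConst ι _ (Matrix mm mm ℂ) Matrix.frobeniusNormedAddCommGroup Matrix.frobeniusNormedSpace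 e * (2 * Real.sqrt (Fintype.card mm)) * (Real.sqrt (Fintype.card mm) * p))))) := by
    intro j
    cases j' with
    | inl μ =>
        simp only [tCoefA_inl, gaugePair_inl]
        rw [← Matrix.sub_apply]
        exact abs_tCoefA_fit_entry_le e (hu' k) hU' μ (hpair μ) hp (kingPr L kk r (cvM d L mv kk hL) x') x' (fun t ht => hF1 k μ _ (hQl k x' hχ μ t ht).1) (fun t ht => (hΩ k μ x' hχ t ht).1) i j
    | inr μ =>
        simp only [tCoefA_inr, gaugePair_inr]
        rw [← Matrix.sub_apply, sub_transpose_fit_entry, abs_neg]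
        exact abs_tCoefA_fit_entry_le e (hu' k) hU' μ (hpair μ) hp ((scShift d L mv kk hL μ).symm (kingPr L kk r (cvM d L mv kk hL) x')) ((scShift' d L mv kk r hL μ).symm x')
          (fun t ht => hF1 k μ _ (hQl k x' hχ μ t ht).2) (fun t ht => (hΩ k μ x' hχ t ht).2) j i
  calc ∑ j, |(scChi d L mv kk hL k (kingPr L kk r (cvM d L mv kk hL) x') • tCoefA ((((L ^ r * L ^ kk : ℕ) : ℝ))⁻¹) (gaugePair (scShift' d L mv kk r hL) (fun μ x' => coordMat e (ContinuousLinearMap.mulLeftRight ℝ (Matrix mm mm ℂ) (u' k x' * U' μ x' * (u' k (scShift' d L mv kk r hL μ x'))ᴴ) (u' k x' * U' μ x' * (u' k (scShift' d L mv kk r hL μ x'))ᴴ)ᴴ))) j' x') i j -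
          (scChi d L mv kk hL k (kingPr L kk r (cvM d L mv kk hL) x') • tCoefA ((((L ^ kk : ℕ) : ℝ))⁻¹) (gaugePair (scShift d L mv kk hL) (fun μ x => coordMat e (ContinuousLinearMap.mulLeftRight ℝ (Matrix mm mm ℂ) (u' k (kingSec (cvM d L mv kk hL) L kk r x) * U μ x * (u' k (kingSec (cvM d L mv kk hL) L kk r (scShift d L mv kk hL μ x)))ᴴ) (u' k (kingSec (cvM d L mv kk hL) L kk r x) * U μ x * (u' k (kingSec (cvM d L mv kk hL) L kk r (scShift d L mv kk hL μ x)))ᴴ)ᴴ))) j' (kingPr L kk r (cvM d L mv kk hL) x')) i j|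
      = ∑ j, |scChi d L mv kk hL k (kingPr L kk r (cvM d L mv kk hL) x')| * |tCoefA ((((L ^ r * L ^ kk : ℕ) : ℝ))⁻¹) (gaugePair (scShift' d L mv kk r hL) (fun μ x' => coordMat e (ContinuousLinearMap.mulLeftRight ℝ (Matrix mm mm ℂ) (u' k x' * U' μ x' * (u' k (scShift' d L mv kk r hL μ x'))ᴴ) (u' k x' * U' μ x' * (u' k (scShift' d L mv kk r hL μ x'))ᴴ)ᴴ))) j' x' i j - tCoefA ((((L ^ kk : ℕ) : ℝ))⁻¹) (gaugePair (scShift d L mv kk hL) (fun μ x => coordMat e (ContinuousLinearMap.mulLeftRight ℝ (Matrix mm mm ℂ) (u' k (kingSec (cvM d L mv kk hL) L kk r x) * U μ x * (u' k (kingSec (cvM d L mv kk hL) L kk r (scShift d L mv kk hL μ x)))ᴴ) (u' k (kingSec (cvM d L mv kk hL) L kk r x) * U μ x * (u' k (kingSec (cvM d L mv kk hL) L kk r (scShift d L mv kk hL μ x)))ᴴ)ᴴ))) j' (kingPr L kk r (cvM d L mv kk hL) x') i j| :=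
        Finset.sum_congr rfl fun j _ => by rw [Matrix.smul_apply, Matrix.smul_apply, smul_eq_mul, smul_eq_mul, ← mul_sub, abs_mul]
    _ ≤ ∑ _j : ι, 1 * (((L ^ r * L ^ kk : ℕ) : ℝ) * (@basisConst ι _ (Matrix mm mm ℂ) Matrix.frobeniusNormedAddCommGroup Matrix.frobeniusNormedSpace e * (2 * Real.sqrt (Fintype.card mm)) * (Real.sqrt (Fintype.card mm) * Ω) + ((1 + Fintype.card ι * (((((L ^ r * L ^ kk : ℕ) : ℝ))⁻¹) * (@basisConst ι _ (Matrix mm mm ℂ) Matrix.frobeniusNormedAddCommGroup Matrix.frobeniusNormedSpace e * (2 * Real.sqrt (Fintype.card mm)) * (Real.sqrt (Fintype.card mm) * p)))) ^ (L ^ r) - 1) * (((((L ^ r * L ^ kk : ℕ) : ℝ))⁻¹) * (@basisConst ι _ (Matrix mm mm ℂ) Matrix.frobeniusNormedAddCommGroup Matrix.frobeniusNormedSpace e * (2 * Real.sqrt (Fintype.card mm)) * (Real.sqrt (Fintype.card mm) * p))))) := Finset.sum_le_sum fun j _ => mul_le_mul hc1 (hentry j) (abs_nonneg _) zero_le_o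ne
    _ = Fintype.card ι * (((L ^ r * L ^ kk : ℕ) : ℝ) * (@basisConst ι _ (Matrix mm mm ℂ) Matrix.frobeniusNormedAddCommGroup Matrix.frobeniusNormedSpace e * (2 * Real.sqrt (Fintype.card mm)) * (Real.sqrt (Fintype.card mm) * Ω) + ((1 + Fintype.card ι * (((((L ^ r * L ^ kk : ℕ) : ℝ))⁻¹) * (@basisConst ι _ (Matrix mm mm ℂ) Matrix.frobeniusNormedAddCommGroup Matrix.frobeniusNormedSpace e * (2 * Real.sqrt (Fintype.card mm)) * (Real.sqrt (Fintype.card mm) * p)))) ^ (L ^ r) - 1) * (((((L ^ r * L ^ kk : ℕ) : ℝ))⁻¹) * (@basisConst ι _ (Matrix mm mm ℂ) Matrix.frobeniusNormedAddCommGroup Matrix.frobeniusNormedSpace e * (2 * Real.sqrt (Fintype.card mm)) * (Real.sqrt (Fintype.card mm) * p))))) := by rw [one_mul, Finset.sum_const, Finset.card_univ, nsmul_eq_mul]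

end Summit.QuantumFields.YangMills.BalabanUVNodes.N15.Gluing

end
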